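import Literature.Algebra.Homology.DiscreteRepLayerColimitSetup
import HarnessLib

/-!
# Lemmas for `Hʳ(Γ, M) = lim→_U Hʳ(Γ⧸U, M^U)`: degree `0`, change of layer under `extInf`,
# connecting maps of the layer sequences, transitivity of the transitions

Topic `Algebra/Homology`; namespace `Literature.Algebra.Homology.DiscreteRep.LayerColimit`.
Definitions with bodies and theorems; no named fact, no `sorry`, no instance.  Sequel of
`DiscreteRepLayerColimitSetup` (door-c4 g14).  Written for Route A of the Poitou–Tate programme of
crux `stmt-BirchSwinnertonDyer-19295` (cell `bsd-schneider-ideate`, seat door-c4 gen 14), item (d)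
(Serre, *Galois Cohomology* I §2.2 Prop. 8; Harari Prop. 4.18 / Remark 4.24).

* §1 open normal subgroups: `coe_isOpen`, `topOpenNormalSubgroup`; the abbreviations
  `LExt U M n = Extⁿ_{Rep k (Γ⧸U)}(k, M^U)` and `infl U M n = extInf U _ M n`.
* §2 DEGREE `0`: `homToLayer` (a morphism `triv k ⟶ M` factors through every layer),
  `extInf_mk₀_homToLayer`, **`exists_extInf_eq_of_zero`** (every class of `Ext⁰(triv k, M)` is
  inflated from EVERY layer) and **`extInf_zero_injective`**.
* §3 CHANGE OF LAYER under `extInf`: **`extInf_layerRes_comp`** — for `W ≤ U`, `b : B ⟶ N^U`,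
  `b' : B' ⟶ N^W`, `c : Res B ⟶ B'` with `c ≫ b' = Res b ≫ incl_{UW}`:
  `extInf_W ((Res w ≫ c) ≫ b') = extInf_U (w ≫ b)`.
* §4 the connecting maps: **`extInf_comp_layer_extClass`** (`extInf_U (y ≫ δ_{S_U}) = (Inf y ≫ φ.τ₃) ≫ δ_T`
  for the layer sequence `S_U` and the presentation `T`), `inf_comp_τ₃_eq_extInf`
  (`Inf y ≫ φ.τ₃ = extInf_U(y ≫ incl)` on `Q`); the morphisms **`layerSCStep M U V`** :
  `(layerSC M U).map Res_{UV} ⟶ layerSC M V` and **`extInfStep_comp_layer_extClass`**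
  (`t_{UV}(w ≫ δ_{S_U}) = (Res w ≫ τ₃) ≫ δ_{S_V}`).
* §5 transitivity: `liftableMono_comp`, the comparison `layerResComp : Res_{UW} ⟶ Res_{UV} ⋙ Res_{VW}`
  (identity on vectors; the two functors are NOT definitionally equal), `mapExactFunctor_layerRes_layerRes`,
  **`extInfStep_extInfStep`**.

HONEST FRAMING: homological algebra only.

## References
* J.-P. Serre, *Galois Cohomology*, Springer (1997), I §2.2 Proposition 8. [SerreGaloisCohomology1997]
* D. Harari, *Galois Cohomology and Class Field Theory* (2020), §4.3 Prop. 4.18, Remark 4.24 (p. 95).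
  [Harari2020]
-/

noncomputable section

universe u

namespace Literature.Algebra.Homology

namespace DiscreteRep

namespace LayerColimit

open CategoryTheory CategoryTheory.Limits CategoryTheory.Abelian Representation

variable {k Γ : Type u} [CommRing k] [Group Γ] [TopologicalSpace Γ] [IsTopologicalGroup Γ]

/-! ## §1 Open normal subgroups and the layer `Ext` groups -/

omit [IsTopologicalGroup Γ] in
/-- An open normal subgroup is open (as a `Subgroup`). [cite: SerreGaloisCohomology1997, I §2.2 Proposition 8] -/
theorem coe_isOpen (U : OpenNormalSubgroup Γ) : IsOpen ((U : Subgroup Γ) : Set Γ) :=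
  U.toOpenSubgroup.isOpen'

variable (Γ) in
/-- The whole group as an open normal subgroup. [cite: SerreGaloisCohomology1997, I §2.2 Proposition 8] -/
def topOpenNormalSubgroup : OpenNormalSubgroup Γ :=
  { toOpenSubgroup := ⊤, isNormal' := inferInstanceAs (⊤ : Subgroup Γ).Normal }

/-- **The layer group `Extⁿ_{Rep k (Γ⧸U)}(k, M^U)`.** [cite: SerreGaloisCohomology1997, I §2.2 Proposition 8] -/
abbrev LExt (U : OpenNormalSubgroup Γ) (M : DiscreteRepCat k Γ) (n : ℕ) : Type u :=
  Ext (Rep.trivial k (Γ ⧸ (U : Subgroup Γ)) k) ((invariantsQuotFunctor k (U : Subgroup Γ)).obj M) n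

/-- **Inflation from the layer `U`**: `infl U M n = extInf U _ M n`.
[cite: SerreGaloisCohomology1997, I §2.2 Proposition 8] -/
abbrev infl (U : OpenNormalSubgroup Γ) (M : DiscreteRepCat k Γ) (n : ℕ) :
    LExt U M n →+ Ext (triv (Γ := Γ) k) M n :=
  extInf (U : Subgroup Γ) (coe_isOpen U) M n

/-- **Transition between layers** `V ≤ U`. [cite: SerreGaloisCohomology1997, I §2.2 Proposition 8] -/
abbrev step (U V : OpenNormalSubgroup Γ) (h : (V : Subgroup Γ) ≤ U) (M : DiscreteRepCat k Γ) (n : ℕ) :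
    LExt U M n →+ LExt V M n :=
  extInfStep (U : Subgroup Γ) (V : Subgroup Γ) h M n

/-! ## §2 Degree `0` -/

section Zero

variable (U : Subgroup Γ) [U.Normal] (hU : IsOpen (U : Set Γ)) (M : DiscreteRepCat k Γ)

/-- A morphism `triv k ⟶ M` factors through the layer `U`: the induced `k ⟶ M^U` (every value of an
equivariant map out of the trivial representation is `Γ`-invariant).
[cite: SerreGaloisCohomology1997, I §2.2 Proposition 8] -/
def homToLayer (f : triv (Γ := Γ) k ⟶ M) :
    Rep.trivial k (Γ ⧸ U) k ⟶ (invariantsQuotFunctor k U).obj M :=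
  homInfToInvariants U (Rep.trivial k (Γ ⧸ U) k) M.obj f.hom

omit [IsTopologicalGroup Γ] in
/-- Formula. [cite: SerreGaloisCohomology1997, I §2.2 Proposition 8] -/
@[simp]
theorem homToLayer_hom_apply_coe (f : triv (Γ := Γ) k ⟶ M) (c : k) :
    ((homToLayer U M f).hom c).1 = f.hom.hom c := rfl

/-- `Inf(homToLayer f) ≫ incl = f`. [cite: SerreGaloisCohomology1997, I §2.2 Proposition 8] -/
theorem infFunctor_map_homToLayer_comp (f : triv (Γ := Γ) k ⟶ M) :
    (infFunctor k U hU).map (homToLayer U M f) ≫ invariantsIncl U hU M = f :=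
  ObjectProperty.hom_ext _ (Rep.hom_ext (DFunLike.ext _ _ fun _ => rfl))

/-- `extInf (mk₀ (homToLayer f)) = mk₀ f`. [cite: SerreGaloisCohomology1997, I §2.2 Proposition 8] -/
theorem extInf_mk₀_homToLayer (f : triv (Γ := Γ) k ⟶ M) :
    extInf U hU M 0 (Ext.mk₀ (homToLayer U M f)) = Ext.mk₀ f := by
  rw [extInf_mk₀, infFunctor_map_homToLayer_comp]
  rfl

/-- **Degree `0`, surjectivity: every class of `Ext⁰_{C_Γ}(k, M)` is inflated from EVERY layer.**
[cite: SerreGaloisCohomology1997, I §2.2 Proposition 8] -/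
theorem exists_extInf_eq_of_zero (x : Ext (triv (Γ := Γ) k) M 0) :
    ∃ y : Ext (Rep.trivial k (Γ ⧸ U) k) ((invariantsQuotFunctor k U).obj M) 0, extInf U hU M 0 y = x := by
  obtain ⟨f, rfl⟩ := (Ext.mk₀_bijective _ _).2 x
  exact ⟨Ext.mk₀ (homToLayer U M f), extInf_mk₀_homToLayer U hU M f⟩

/-- A morphism `g : k ⟶ M^U` with `Inf g ≫ incl = 0` is zero. [cite: SerreGaloisCohomology1997, I §2.2 Proposition 8] -/
theorem eq_zero_of_infFunctor_map_comp_incl_eq_zero {B : Rep.{u} k (Γ ⧸ U)}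
    (g : B ⟶ (invariantsQuotFunctor k U).obj M)
    (hg : (infFunctor k U hU).map g ≫ invariantsIncl U hU M = 0) : g = 0 := by
  refine Rep.hom_ext (DFunLike.ext _ _ fun b => Subtype.ext ?_)
  have h := congrArg (fun φ => φ.hom.hom b) hg
  exact h

/-- **Degree `0`, injectivity: `extInf_U` is injective on `Ext⁰`.**
[cite: SerreGaloisCohomology1997, I §2.2 Proposition 8] -/
theorem extInf_zero_injective :
    Function.Injective (extInf U hU M 0) := by
  rw [injective_iff_map_eq_zero]
  intro y hy
  obtain ⟨g, rfl⟩ := (Ext.mk₀_bijective _ _).2 y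
  rw [extInf_mk₀] at hy
  have hy' : (infFunctor k U hU).map g ≫ invariantsIncl U hU M = 0 := (Ext.mk₀_eq_zero_iff _).1 hy
  rw [eq_zero_of_infFunctor_map_comp_incl_eq_zero U hU M g hy', Ext.mk₀_zero]

end Zero

/-! ## §3 Change of layer under `extInf` -/

section Change

variable (U W : Subgroup Γ) [U.Normal] [W.Normal] (hU : IsOpen (U : Set Γ)) (hW : IsOpen (W : Set Γ))
  (hWU : W ≤ U) (N : DiscreteRepCat k Γ)

/-- **Change of layer under `extInf`**: for `W ≤ U`, `b : B ⟶ N^U`, `b' : B' ⟶ N^W` and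
`c : Res_{UW} B ⟶ B'` with `c ≫ b' = Res_{UW} b ≫ incl_{UW}`, and `w ∈ Extⁿ(k, B)`:
`extInf_W ((Res w ≫ c) ≫ b') = extInf_U (w ≫ b)`. [cite: SerreGaloisCohomology1997, I §2.2 Proposition 8] -/
theorem extInf_layerRes_comp {B : Rep.{u} k (Γ ⧸ U)} {B' : Rep.{u} k (Γ ⧸ W)}
    (b : B ⟶ (invariantsQuotFunctor k U).obj N) (b' : B' ⟶ (invariantsQuotFunctor k W).obj N)
    (c : (layerRes k U W hWU).obj B ⟶ B')
    (hc : c ≫ b' = (layerRes k U W hWU).map b ≫ invariantsStepIncl U W hWU N) {n : ℕ}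
    (w : Ext (Rep.trivial k (Γ ⧸ U) k) B n) :
    extInf W hW N n ((((w.mapExactFunctor (layerRes k U W hWU)).comp (Ext.mk₀ c) (add_zero n)).comp
        (Ext.mk₀ b') (add_zero n))) =
      extInf U hU N n (w.comp (Ext.mk₀ b) (add_zero n)) := by
  rw [← extInf_extInfStep U W hU hW hWU N n, extInfStep_apply]
  congr 1
  change ((w.mapExactFunctor (layerRes k U W hWU)).comp (Ext.mk₀ c) (add_zero n)).comp
      (Ext.mk₀ b') (add_zero n) =
    ((w.comp (Ext.mk₀ b) (add_zero n)).mapExactFunctor (layerRes k U W hWU)).comp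
      (Ext.mk₀ (invariantsStepIncl U W hWU N)) (add_zero n)
  rw [Ext.comp_assoc_of_third_deg_zero, Ext.mk₀_comp_mk₀, hc, ← Ext.mk₀_comp_mk₀,
    ← Ext.comp_assoc_of_third_deg_zero, Ext.mapExactFunctor_comp, Ext.mapExactFunctor_mk₀]

end Change

/-! ## §4 Connecting maps of the layer sequences -/

section Connecting

variable (M : DiscreteRepCat k Γ) (U : Subgroup Γ) [U.Normal] (hU : IsOpen (U : Set Γ))

/-- **`extInf_U (y ≫ δ_{S_U}) = (Inf y ≫ φ.τ₃) ≫ δ_T`** for the layer sequence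
`S_U : 0 → M^U → I^U → liftable → 0`, the presentation `T : 0 → M → I → Q → 0` and the morphism
`φ = layerSCHom`. [cite: SerreGaloisCohomology1997, I §2.2 Proposition 8][cite: Harari2020, §4.3 Remark 4.24] -/
theorem extInf_comp_layer_extClass {n : ℕ}
    (y : Ext (Rep.trivial k (Γ ⧸ U) k) (layerSC M U).X₃ n) :
    extInf U hU M (n + 1) (y.comp (layerSC_shortExact M U).extClass (rfl : n + 1 = n + 1)) =
      ((y.mapExactFunctor (infFunctor k U hU)).comp (Ext.mk₀ (layerSCHom M U hU).τ₃) (add_zero n)).comp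
        (presSC_shortExact M).extClass (rfl : n + 1 = n + 1) := by
  rw [extInf_apply, mapExactFunctor_infFunctor_comp_extClass U hU (layerSC_shortExact M U)
    (presSC_shortExact M) (layerSCHom M U hU) y]
  rfl

/-- **`Inf y ≫ φ.τ₃ = extInf_U (y ≫ incl)` on `Q`.** [cite: SerreGaloisCohomology1997, I §2.2 Proposition 8] -/
theorem inf_comp_τ₃_eq_extInf {n : ℕ} (y : Ext (Rep.trivial k (Γ ⧸ U) k) (layerSC M U).X₃ n) :
    (y.mapExactFunctor (infFunctor k U hU)).comp (Ext.mk₀ (layerSCHom M U hU).τ₃) (add_zero n) =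
      extInf U hU (presQ M) n (y.comp (Ext.mk₀ (liftableIncl M U U)) (add_zero n)) := by
  rw [layerSCHom_τ₃, extInf_apply, Ext.mapExactFunctor_comp, Ext.mapExactFunctor_mk₀,
    Ext.comp_assoc_of_third_deg_zero, Ext.mk₀_comp_mk₀]

variable (V : Subgroup Γ) [V.Normal] (hV : IsOpen (V : Set Γ)) (hVU : V ≤ U)

/-- **The morphism `(layerSC M U).map Res_{UV} ⟶ layerSC M V`** of short complexes in `Rep k (Γ⧸V)`
(the inclusions `M^U ⊆ M^V`, `I^U ⊆ I^V`, and on the third terms `Res(liftable U U) → liftable U V → liftable V V`).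
[cite: SerreGaloisCohomology1997, I §2.2 Proposition 8] -/
def layerSCStep : (layerSC M U).map (layerRes k U V hVU) ⟶ layerSC M V where
  τ₁ := invariantsStepIncl U V hVU M
  τ₂ := invariantsStepIncl U V hVU (pres M)
  τ₃ := (layerRes k U V hVU).map (liftableMono M U hVU) ≫ liftableToLayer M U V hVU
  comm₁₂ := Rep.hom_ext (DFunLike.ext _ _ fun _ => Subtype.ext rfl)
  comm₂₃ := Rep.hom_ext (DFunLike.ext _ _ fun _ => Subtype.ext (Subtype.ext rfl))

/-- The third component of `layerSCStep`. [cite: SerreGaloisCohomology1997, I §2.2 Proposition 8] -/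
theorem layerSCStep_τ₃ :
    (layerSCStep M U V hVU).τ₃ =
      (layerRes k U V hVU).map (liftableMono M U hVU) ≫ liftableToLayer M U V hVU := rfl

/-- `τ₃ ≫ incl_V = Res(incl_U) ≫ (Q^U ⊆ Q^V)`. [cite: SerreGaloisCohomology1997, I §2.2 Proposition 8] -/
theorem layerSCStep_τ₃_comp_incl :
    (layerSCStep M U V hVU).τ₃ ≫ liftableIncl M V V =
      (layerRes k U V hVU).map (liftableIncl M U U) ≫ invariantsStepIncl U V hVU (presQ M) :=
  Rep.hom_ext (DFunLike.ext _ _ fun _ => Subtype.ext rfl)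

/-- **`t_{UV}(w ≫ δ_{S_U}) = (Res w ≫ τ₃) ≫ δ_{S_V}`.** [cite: SerreGaloisCohomology1997, I §2.2 Proposition 8] -/
theorem extInfStep_comp_layer_extClass {n : ℕ}
    (w : Ext (Rep.trivial k (Γ ⧸ U) k) (layerSC M U).X₃ n) :
    extInfStep U V hVU M (n + 1) (w.comp (layerSC_shortExact M U).extClass (rfl : n + 1 = n + 1)) =
      ((w.mapExactFunctor (layerRes k U V hVU)).comp (Ext.mk₀ (layerSCStep M U V hVU).τ₃)
          (add_zero n)).comp (layerSC_shortExact M V).extClass (rfl : n + 1 = n + 1) := by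
  rw [extInfStep_apply, ExtFunctoriality.mapExactFunctor_comp_extClass_of_hom (layerRes k U V hVU)
    (layerSC_shortExact M U) (layerSC_shortExact M V) (layerSCStep M U V hVU) w]
  rfl

end Connecting

/-! ## §5 Transitivity of the transitions -/

section Transitive

variable (M : DiscreteRepCat k Γ) (U V W : Subgroup Γ) [U.Normal] [V.Normal] [W.Normal]
  (hVU : V ≤ U) (hWV : W ≤ V)

/-- `liftableMono` composes. [cite: SerreGaloisCohomology1997, I §2.2 Proposition 8] -/
theorem liftableMono_comp {X : Subgroup Γ} [X.Normal] {W₁ W₂ W₃ : Subgroup Γ} [W₁.Normal] [W₂.Normal]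
    [W₃.Normal] (h₂₁ : W₂ ≤ W₁) (h₃₂ : W₃ ≤ W₂) :
    liftableMono M X h₂₁ ≫ liftableMono M X h₃₂ = liftableMono M X (h₃₂.trans h₂₁) :=
  Rep.hom_ext (DFunLike.ext _ _ fun _ => Subtype.ext rfl)

omit [TopologicalSpace Γ] [IsTopologicalGroup Γ] in
/-- `Res_{UW}` and `Res_{VW} ∘ Res_{UV}` agree on objects up to the identity of the underlying module
(the two actions `γ ↦ ρ(q_{UW} γ)` and `γ ↦ ρ(q_{UV}(q_{VW} γ))` coincide): the comparison natural
transformation. [cite: SerreGaloisCohomology1997, I §2.2 Proposition 8] -/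
def layerResComp : layerRes k U W (hWV.trans hVU) ⟶ layerRes k U V hVU ⋙ layerRes k V W hWV where
  app _ := Rep.ofHom ⟨LinearMap.id, fun γ => QuotientGroup.induction_on γ fun _ => rfl⟩
  naturality _ _ _ := Rep.hom_ext (DFunLike.ext _ _ fun _ => rfl)

omit [TopologicalSpace Γ] [IsTopologicalGroup Γ] in
/-- On the trivial representation the comparison is the identity.
[cite: SerreGaloisCohomology1997, I §2.2 Proposition 8] -/
theorem layerResComp_app_trivial :
    (layerResComp U V W hVU hWV).app (Rep.trivial k (Γ ⧸ U) k) = 𝟙 (Rep.trivial k (Γ ⧸ W) k) := rfl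

omit [IsTopologicalGroup Γ] in
/-- `comparison ≫ Res_{VW}(incl_{UV}) ≫ incl_{VW} = incl_{UW}`. [cite: SerreGaloisCohomology1997, I §2.2 Proposition 8] -/
theorem layerResComp_app_comp_invariantsStepIncl :
    (layerResComp U V W hVU hWV).app ((invariantsQuotFunctor k U).obj M) ≫
        (layerRes k V W hWV).map (invariantsStepIncl U V hVU M) ≫ invariantsStepIncl V W hWV M =
      invariantsStepIncl U W (hWV.trans hVU) M :=
  Rep.hom_ext (DFunLike.ext _ _ fun _ => Subtype.ext rfl)

omit [TopologicalSpace Γ] [IsTopologicalGroup Γ] in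
/-- **`Res_{VW} (Res_{UV} y) = Res_{UW} y ≫ comparison`** on `Ext` (from `mapExactFunctor_natTrans`
and `mapExactFunctor_comp_functor`). [cite: SerreGaloisCohomology1997, I §2.2 Proposition 8] -/
theorem mapExactFunctor_layerRes_layerRes {B : Rep.{u} k (Γ ⧸ U)} {n : ℕ}
    (y : Ext (Rep.trivial k (Γ ⧸ U) k) B n) :
    (y.mapExactFunctor (layerRes k U V hVU)).mapExactFunctor (layerRes k V W hWV) =
      (y.mapExactFunctor (layerRes k U W (hWV.trans hVU))).comp
        (Ext.mk₀ ((layerResComp U V W hVU hWV).app B)) (add_zero n) := by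
  haveI := comp_preservesFiniteLimits (layerRes k U V hVU) (layerRes k V W hWV)
  haveI := comp_preservesFiniteColimits (layerRes k U V hVU) (layerRes k V W hWV)
  rw [← ExtFunctoriality.mapExactFunctor_comp_functor,
    ← ExtFunctoriality.mapExactFunctor_natTrans (layerResComp U V W hVU hWV) y,
    layerResComp_app_trivial]
  exact (Ext.mk₀_id_comp _).symm

omit [IsTopologicalGroup Γ] in
/-- **Transitivity: `t_{VW} (t_{UV} y) = t_{UW} y`.** [cite: SerreGaloisCohomology1997, I §2.2 Proposition 8] -/
theorem extInfStep_extInfStep (n : ℕ)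
    (y : Ext (Rep.trivial k (Γ ⧸ U) k) ((invariantsQuotFunctor k U).obj M) n) :
    extInfStep V W hWV M n (extInfStep U V hVU M n y) = extInfStep U W (hWV.trans hVU) M n y := by
  change (((y.mapExactFunctor (layerRes k U V hVU)).comp (Ext.mk₀ (invariantsStepIncl U V hVU M))
      (add_zero n)).mapExactFunctor (layerRes k V W hWV)).comp
      (Ext.mk₀ (invariantsStepIncl V W hWV M)) (add_zero n) =
    (y.mapExactFunctor (layerRes k U W (hWV.trans hVU))).comp
      (Ext.mk₀ (invariantsStepIncl U W (hWV.trans hVU) M)) (add_zero n)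
  rw [Ext.mapExactFunctor_comp, Ext.mapExactFunctor_mk₀, Ext.comp_assoc_of_third_deg_zero,
    Ext.mk₀_comp_mk₀, mapExactFunctor_layerRes_layerRes]
  refine (Ext.comp_assoc_of_third_deg_zero _ _ _ _).trans ?_
  congr 1
  exact (Ext.mk₀_comp_mk₀ _ _).trans
    (congrArg Ext.mk₀ (layerResComp_app_comp_invariantsStepIncl M U V W hVU hWV))

end Transitive

end LayerColimit

end DiscreteRep

end Literature.Algebra.Homology
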